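import Summits.SmoothPoincare4.SmoothPoincare4.Theorems.ConvexBisectionAcyclicBisectionExistsDualDataHandle
import Summits.SmoothPoincare4.SmoothPoincare4.Theorems.ConvexBisectionAcyclicBisectionExistsPushedPrefixPush
import HarnessLib

/-!
# The dual multi-attachment data, IVb: the closed roof shell `‖y_λ‖² ≤ 1/4`, values in `{Φ ≤ 0}`
(helper file 4b of the wave-5 brick T3b (iv) "the dual multi-attachment data `D₂` on the complement
piece `W₂`" for stub `stub_T3_dualPresentation` (T3), line `modp-braid-orbits`, crux
`ConvexBisection.AcyclicBisectionExists`, item stmt-SmoothPoincare4-10508; lead c5, worker X1)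

Sequel of `…DualDataHandle.lean` (independent of files III–IV).  The assembler of the T3 node (X2) needs the
seam clause `E = j_N` at old-seam points whose dual-tube coordinates satisfy `‖y_λ‖² ≤ 1/4` NON-STRICTLY
(the boundary case `‖y_λ‖² = 1/4` corresponds to Y5's unmoved level `‖t_λ‖² = 1 - 3κ²/4`).  V5's F-top
identity `modelF_eq_dualVec_handleInversion` is stated for `3/4 < ‖x_λ‖²`; here:

* `modelF_eq_dualVec_handleInversion_of_le` — the same identity for `3/4 ≤ ‖x_λ‖² < 1` (V5's computation
  verbatim: the cut-offs are already `1` at `s = 3/4`);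
* `chart_modelF_inv_eq_jN_of_le` — for a family `g` read as dual vectors (HT), `Θ_{f j} (𝓕 (α y)) = j_N (g j y)`
  for all `y ∈ T` with `‖y_λ‖² ≤ 1/4`; `extension_eq_jN_of_shallow_le` — the stretch `E` is `j_N` at every
  point all of whose tube coordinates have `‖y_λ‖² ≤ 1/4`;
* `levelFn_extension_nonpos` — the stretch takes values in `{Φ ≤ 0}` off the attaching circles.

Everything here is proved; no named facts, no definitions.

## References
* J. Milnor, *Lectures on the h-cobordism theorem* (1965), §3. [MilnorHCobordism1965]
* A. A. Kosinski, *Differential Manifolds* (1993), VI §6, (6.1). [Kosinski1993]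
-/

noncomputable section

-- the prescribed namespace `Summit.<P>.<Sub>.…` duplicates `SmoothPoincare4` (P = Sub)
set_option linter.dupNamespace false

open scoped Manifold ContDiff Topology

namespace Summit.SmoothPoincare4.SmoothPoincare4.Theorems.AcyclicBisectionExists.ModpBraidOrbits

open Set Function Metric Filter Topology
open Literature.Topology.FourManifolds Literature.Topology.FourManifolds.HandleAttachingMap

/-! ### §1 F-top on the closed shell `3/4 ≤ ‖x_λ‖² < 1` -/

section Top

/-- **`𝓕 = Π ∘ α` on the CLOSED top shell**: for `x ∈ D⁴` with `3/4 ≤ ‖x_λ‖² < 1`,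
`modelF a κ δ x = dualVec a κ δ (α x)` (V5's `modelF_eq_dualVec_handleInversion` with the non-strict lower
bound; the cut-offs `𝓅 = κ² s`, `q̃ = F/s` hold for `s ≥ 3/4`). [cite: Kosinski1993, VI §6] -/
theorem modelF_eq_dualVec_handleInversion_of_le {a κ δ : ℝ} (hκ : 0 < κ) (x : EuclideanSpace ℝ (Fin 4))
    (hx : ‖x‖ ≤ 1) (hs : 3 / 4 ≤ lamSq 2 x) (hs1 : lamSq 2 x < 1) :
    modelF a κ δ x =
      dualVec a κ δ (handleInversionPt (⟨x, mem_closedBall_zero_iff.2 hx⟩ :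
        Metric.closedBall (0 : EuclideanSpace ℝ (Fin 4)) 1) (by show lamSq 2 x ≠ 0; linarith)
        (by show lamSq 2 x ≠ 1; exact ne_of_lt hs1)) := by
  set s := lamSq 2 x with hs_def
  have hs0 : 0 < s := by linarith
  have hs1' : 0 < 1 - s := by linarith
  have hlam : ‖lamPart x‖ = Real.sqrt s := by
    rw [← Real.sqrt_sq (norm_nonneg (lamPart x)), norm_lamPart_sq]
  set y := handleInversionPt (⟨x, mem_closedBall_zero_iff.2 hx⟩ :
      Metric.closedBall (0 : EuclideanSpace ℝ (Fin 4)) 1) (by show lamSq 2 x ≠ 0; linarith)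
      (by show lamSq 2 x ≠ 1; exact ne_of_lt hs1) with hy
  have hyv : tubeVec y = handleInversion 2 x := rfl
  have hc : 0 < Real.sqrt (1 - s) / Real.sqrt s := div_pos (Real.sqrt_pos.2 hs1') (Real.sqrt_pos.2 hs0)
  have hc' : 0 ≤ Real.sqrt s / Real.sqrt (1 - s) := (div_pos (Real.sqrt_pos.2 hs0) (Real.sqrt_pos.2 hs1')).le
  have hfib : tubeFibre y = (Real.sqrt s / Real.sqrt (1 - s)) • muPart x := by
    rw [tubeFibre, hyv, muPart_handleInversion]
  have hang : (tubeAngle y : EuclideanSpace ℝ (Fin 2)) = ‖lamPart x‖⁻¹ • lamPart x := by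
    rw [coe_tubeAngle, hyv, lamPart_handleInversion, norm_smul, Real.norm_of_nonneg hc.le, smul_smul,
      mul_inv, mul_assoc, mul_comm (‖lamPart x‖⁻¹), ← mul_assoc, inv_mul_cancel₀ hc.ne', one_mul]
  have hdep : tubeDepth y = s * (1 - uOf x) := by
    rw [tubeDepth, hyv, norm_handleInversion_sq hs0 hs1, uOf, sOf_eq_lamSq, ← hs_def, norm_muPart_sq]
    field_simp
    ring
  have hfib2 : ‖tubeFibre y‖ ^ 2 = s * uOf x := by
    rw [hfib, norm_smul, mul_pow, Real.norm_of_nonneg hc', div_pow, Real.sq_sqrt hs0.le,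
      Real.sq_sqrt hs1'.le, uOf, sOf_eq_lamSq, ← hs_def, norm_muPart_sq]
    field_simp
  have hR : Real.sqrt (1 + gProfile a (δ * tubeDepth y) - κ ^ 2 * ‖tubeFibre y‖ ^ 2) =
      Real.sqrt (FTop a κ δ s (uOf x)) := by
    rw [hdep, hfib2]; rfl
  have hs34 : (3 : ℝ) / 4 ≤ sOf x := by rw [sOf_eq_lamSq]; exact hs
  have hs14 : (1 : ℝ) / 4 ≤ sOf x := by linarith
  have hp : Real.sqrt (pFun κ (sOf x) / (1 - sOf x)) = κ * (Real.sqrt s / Real.sqrt (1 - s)) := by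
    have : pFun κ (sOf x) / (1 - sOf x) = (κ * (Real.sqrt s / Real.sqrt (1 - s))) ^ 2 := by
      rw [pFun_of_ge κ hs14, sOf_eq_lamSq, ← hs_def, mul_pow, div_pow, Real.sq_sqrt hs0.le,
        Real.sq_sqrt hs1'.le]
      ring
    rw [this, Real.sqrt_sq (mul_nonneg hκ.le hc')]
  have hq : Real.sqrt (qTilde a κ δ (sOf x) (uOf x)) = Real.sqrt (FTop a κ δ s (uOf x)) * ‖lamPart x‖⁻¹ := by
    rw [qTilde_of_ge a κ δ hs34, sOf_eq_lamSq, ← hs_def, Real.sqrt_div' _ hs0.le, hlam, div_eq_mul_inv]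
  rw [modelF, dualVec, hR, hfib, hang, smul_smul, lamEmbed_smul, muEmbed_smul, smul_smul, hp, hq]

end Top

/-! ### §2 The stretch on the closed roof shells; values in `{Φ ≤ 0}` -/

section Shallow

variable {B : Type} [TopologicalSpace B] [T2Space B] [ChartedSpace (EuclideanHalfSpace 4) B]
  {ι : Type} [Finite ι] {h : ι → HandleAttachingMap 3 2 B}
  {X : Type} [TopologicalSpace X] [ChartedSpace (EuclideanHalfSpace 4) X] [IsManifold (𝓡∂ 4) ∞ X]
  (D : MultiAttachmentData h (𝓡∂ 4) X) {ι' : Type} (f : ι' → ι) {bX : BoundaryData (𝓡∂ 4) X (𝓡 3)}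
  {W : Type} [TopologicalSpace W] [ChartedSpace (EuclideanHalfSpace 4) W]
  [IsManifold (𝓡∂ 4) ∞ W] {bW : BoundaryData (𝓡∂ 4) W (𝓡 3)} [Nonempty bX.carrier]
  (G : BoundaryGlueData bX bW) {a κ δ : ℝ} (g : ι' → HandleAttachingMap 3 2 W)

/-- **On the closed roof shell the tube piece IS the attaching map read in `M'`**: for `y ∈ T` with
`‖y_λ‖² ≤ 1/4` and a family `g` read as dual vectors (HT), `Θ_{f j} (𝓕 (α y)) = j_N (g j y)`.
[cite: MilnorHCobordism1965, §3] -/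
theorem chart_modelF_inv_eq_jN_of_le (hκ : 0 < κ)
    (hT : ∀ (j : ι') (y : ↥(handleTube 3 2)), gluedHandleChart D (f j) G a (dualVec a κ δ y) = G.jN ((g j).toFun y))
    (j : ι') (y : ↥(handleTube 3 2))
    (hy : lamSq 2 (((y : closedBall (0 : EuclideanSpace ℝ (Fin 4)) 1) : EuclideanSpace ℝ (Fin 4))) ≤ 1 / 4) :
    gluedHandleChart D (f j) G a (modelF a κ δ
        (handleInversion 2 (((y : closedBall (0 : EuclideanSpace ℝ (Fin 4)) 1) : EuclideanSpace ℝ (Fin 4))))) =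
      G.jN ((g j).toFun y) := by
  have hy1 : lamSq 2 (((y : closedBall (0 : EuclideanSpace ℝ (Fin 4)) 1) : EuclideanSpace ℝ (Fin 4))) ≠ 1 := by
    intro h1; rw [h1] at hy; norm_num at hy
  obtain ⟨hx1, hxs, h0, -⟩ := tube_inv_mem y hy1
  set x := handleInversion 2 (((y : closedBall (0 : EuclideanSpace ℝ (Fin 4)) 1) : EuclideanSpace ℝ (Fin 4))) with hx
  have hs : 3 / 4 ≤ lamSq 2 x := by rw [hxs]; linarith
  have hs1 : lamSq 2 x < 1 := by rw [hxs]; linarith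
  rw [modelF_eq_dualVec_handleInversion_of_le hκ x hx1 hs hs1]
  have hyy : handleInversionPt (⟨x, mem_closedBall_zero_iff.2 hx1⟩ : closedBall (0 : EuclideanSpace ℝ (Fin 4)) 1)
      (by show lamSq 2 x ≠ 0; linarith) (by show lamSq 2 x ≠ 1; exact ne_of_lt hs1) = y := by
    apply Subtype.ext; apply Subtype.ext
    rw [coe_coe_handleInversionPt]
    exact handleInversion_handleInversion h0 (by linarith)
  rw [hyy, hT]

/-- **`E = j_N` at every point all of whose tube coordinates have `‖y_λ‖² ≤ 1/4`** (in particular at every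
point off the tubes). [cite: MilnorHCobordism1965, §3] -/
theorem extension_eq_jN_of_shallow_le (hκ : 0 < κ)
    (hT : ∀ (j : ι') (y : ↥(handleTube 3 2)), gluedHandleChart D (f j) G a (dualVec a κ δ y) = G.jN ((g j).toFun y))
    {E : W → G.d₂.Glued}
    (hE1 : ∀ w, (∀ (j : ι') (y : ↥(handleTube 3 2)), (g j).toFun y ≠ w) → E w = G.jN w)
    (hE2 : ∀ (j : ι') (y : ↥(handleTube 3 2)),
      lamSq 2 (((y : closedBall (0 : EuclideanSpace ℝ (Fin 4)) 1) : EuclideanSpace ℝ (Fin 4))) ≠ 1 →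
      E ((g j).toFun y) = gluedHandleChart D (f j) G a (modelF a κ δ
        (handleInversion 2 (((y : closedBall (0 : EuclideanSpace ℝ (Fin 4)) 1) : EuclideanSpace ℝ (Fin 4))))))
    {w : W} (hw : ∀ (j : ι') (y : ↥(handleTube 3 2)), (g j).toFun y = w →
      lamSq 2 (((y : closedBall (0 : EuclideanSpace ℝ (Fin 4)) 1) : EuclideanSpace ℝ (Fin 4))) ≤ 1 / 4) :
    E w = G.jN w := by
  by_cases hex : ∃ (j : ι') (y : ↥(handleTube 3 2)), (g j).toFun y = w
  · obtain ⟨j, y, rfl⟩ := hex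
    have hy := hw j y rfl
    have hy1 : lamSq 2 (((y : closedBall (0 : EuclideanSpace ℝ (Fin 4)) 1) : EuclideanSpace ℝ (Fin 4))) ≠ 1 := by
      intro h1; rw [h1] at hy; norm_num at hy
    rw [hE2 j y hy1]
    exact chart_modelF_inv_eq_jN_of_le D f G g hκ hT j y hy
  · push Not at hex
    exact hE1 w hex

variable [CompactSpace X] [T2Space X] [T2Space W] [CompactSpace W] [Finite ι'] (col : (BoundaryManifold.boundaryData 3 W).Collar)

/-- **The stretch takes values in the complement piece `{Φ ≤ 0}`** off the attaching circles.
[cite: Milnor1963, Thm. 3.1] -/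
theorem levelFn_extension_nonpos (ha : 0 < a) (hf : Injective f) (hCM : ∀ j, CollarAdapted D (f j) G a)
    (hκ : 0 < κ) (hκ2 : κ ≤ 1 / 2) (hκ1 : κ ≤ 1) (hδ : 0 < δ) (hδ2 : δ ≤ 1 / 2) (haδ : a * δ ≤ 1 / 5)
    (hcol : ∀ (w : (BoundaryManifold.boundaryData 3 W).carrier) (x : bW.carrier),
      (BoundaryManifold.boundaryData 3 W).incl w = bW.incl x →
      ∀ t : Set.Icc (0 : ℝ) 1, col.toFun (w, t) = G.CN.toFun x ((t : ℝ) / (2 - t)))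
    (hdisj : Pairwise fun i j => Disjoint (range (g i).toFun) (range (g j).toFun)) {E : W → G.d₂.Glued}
    (hE1 : ∀ w, (∀ (j : ι') (y : ↥(handleTube 3 2)), (g j).toFun y ≠ w) → E w = G.jN w)
    (hE2 : ∀ (j : ι') (y : ↥(handleTube 3 2)),
      lamSq 2 (((y : closedBall (0 : EuclideanSpace ℝ (Fin 4)) 1) : EuclideanSpace ℝ (Fin 4))) ≠ 1 →
      E ((g j).toFun y) = gluedHandleChart D (f j) G a (modelF a κ δ
        (handleInversion 2 (((y : closedBall (0 : EuclideanSpace ℝ (Fin 4)) 1) : EuclideanSpace ℝ (Fin 4))))))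
    (w : ↥(coresComplement g)) : levelFn D f G a κ δ (E w) ≤ 0 := by
  by_cases hex : ∃ (j : ι') (y : ↥(handleTube 3 2)), (g j).toFun y = (w : W)
  · obtain ⟨j, y, hy⟩ := hex
    have hy1 : lamSq 2 (((y : closedBall (0 : EuclideanSpace ℝ (Fin 4)) 1) : EuclideanSpace ℝ (Fin 4))) ≠ 1 :=
      (apply_mem_coresComplement_iff hdisj j y).1 (hy ▸ w.2)
    rw [← hy, hE2 j y hy1]
    obtain ⟨hx1, hxs, h0, -⟩ := tube_inv_mem y hy1
    exact levelFn_gluedHandleChart_nonpos D f G ha hf hCM hκ hκ2 hκ1 hδ hδ2 col hcol j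
      (modelF_mem_chartDom ha hκ hκ2 hδ hδ2 haδ hx1 (by rw [sOf_eq_lamSq, hxs]; linarith)).1
  · push Not at hex
    rw [hE1 w hex]
    exact levelFn_jN_nonpos D f G ha hf hCM hκ hκ2 hδ hδ2 _


end Shallow

/-- **Registered helper `helper_modelF_eq_dualVec_of_le` (brick T3b (iv), sub-goal of
`stub_T3_dualPresentation`, wave 5, lead c5): on the CLOSED top shell `3/4 ≤ ‖x_λ‖² < 1` the model of the
dual handle embedding IS Kosinski's identification** — `modelF a κ δ x = dualVec a κ δ y` whenever
`y ∈ T` is the inverted point `α x` (non-strict version of V5's `helper_modelF_eq_dualVec`, needed for the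
seam clause of the dual presentation at the boundary level `‖y_λ‖² = 1/4`). [cite: Kosinski1993, VI §6] -/
theorem helper_modelF_eq_dualVec_of_le : ∀ {a κ δ : ℝ}, 0 < κ → ∀ (x : EuclideanSpace ℝ (Fin 4)), ‖x‖ ≤ 1 → 3 / 4 ≤ Literature.Topology.FourManifolds.lamSq 2 x → Literature.Topology.FourManifolds.lamSq 2 x < 1 → ∀ (y : ↥(Literature.Topology.FourManifolds.handleTube 3 2)), Literature.Topology.FourManifolds.tubeVec y = Literature.Topology.FourManifolds.handleInversion 2 x → Summit.SmoothPoincare4.SmoothPoincare4.Theorems.AcyclicBisectionExists.ModpBraidOrbits.modelF a κ δ x = Summit.SmoothPoincare4.SmoothPoincare4.Theorems.AcyclicBisectionExists.ModpBraidOrbits.dualVec a κ δ y := by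
  intro a κ δ hκ x hx hs hs1 y hy
  have : y = handleInversionPt (⟨x, mem_closedBall_zero_iff.2 hx⟩ :
      Metric.closedBall (0 : EuclideanSpace ℝ (Fin 4)) 1) (by show lamSq 2 x ≠ 0; linarith)
      (by show lamSq 2 x ≠ 1; exact ne_of_lt hs1) := Subtype.ext (Subtype.ext hy)
  rw [this]
  exact modelF_eq_dualVec_handleInversion_of_le hκ x hx hs hs1

end Summit.SmoothPoincare4.SmoothPoincare4.Theorems.AcyclicBisectionExists.ModpBraidOrbits

end
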